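import Summits.Ventures.Crystal3D.Theorems.StickyWulffConstantNoReconstructionGainNoK1122
import Summits.Ventures.Crystal3D.Theorems.StickyWulffConstantNoReconstructionGainExactThinNoCriminal
import HarnessLib

/-!
# A bond of a unit-ball packing has at most five common neighbours (criminal anatomy brick, line `replication-exactness`)

HONEST FRAMING. Part of the venture `Summits/Ventures/Crystal3D` (cell `crystal3d-full`), helper `--supports` the
crux `NoReconstructionGain` (stmt-Ventures-19144, route `route-Ventures-StickyWulffConstant`), lead wulff-p1 g19.
Completes the «common neighbours of a bond» package (`no_K1122_contacts`: no 4-ring; `no_closed_five_ring`: no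
5-ring; here: at most five of them): the common neighbours of two touching balls `u, a` are unit vectors from `u` at
height exactly `1/2` over `a − u`, i.e. on a circle of radius `√3/2`, pairwise `≥ 1` apart; six of them would give six
planar vectors of norm² `3/4` two of which are within `60°` (pigeonhole, as in `exists_cos_sub_ge`), hence at squared
distance `≤ 3/4 < 1`.

* `exists_cos_sub_ge_six` — among six angles in `(−π, π]` two are within `π/3` on the circle;
* `six_ring_vectors_false` — six unit vectors `w` with `⟪wᵢ, e⟫ = 1/2` pairwise `≥ 1` apart do not exist;
* `card_commonNeighbours_le_five` — two touching balls have at most five common touching neighbours in any packing.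

WHAT THIS IS NOT: nothing about films by itself; rung F-C1 not moved.
-/

noncomputable section

namespace Summit.Ventures.Crystal3D.Theorems

open Summit.Ventures.Crystal3D
open scoped InnerProductSpace Real
open Finset

/-- Among six angles in `(-π, π]` two are within `π/3` of each other on the circle. -/
theorem exists_cos_sub_ge_six (θ : Fin 6 → ℝ) (hlo : ∀ i, -π < θ i) (hhi : ∀ i, θ i ≤ π) :
    ∃ i j, i ≠ j ∧ Real.cos (π / 3) ≤ Real.cos (θ i - θ j) := by
  classical
  have hπ0 := Real.pi_pos
  set ℓ : ℝ := π / 3 with hℓ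
  have hℓ0 : 0 < ℓ := by rw [hℓ]; positivity
  have hclose : ∀ i j, |θ i - θ j| ≤ ℓ → Real.cos ℓ ≤ Real.cos (θ i - θ j) := by
    intro i j h
    rw [← Real.cos_abs (θ i - θ j)]
    exact Real.cos_le_cos_of_nonneg_of_le_pi (abs_nonneg _) (by rw [hℓ]; linarith) h
  have hfar : ∀ i j, 2 * π - ℓ ≤ θ i - θ j → Real.cos ℓ ≤ Real.cos (θ i - θ j) := by
    intro i j h
    have h2 : θ i - θ j < 2 * π := by linarith [hlo j, hhi i]
    rw [← Real.cos_two_pi_sub (θ i - θ j)]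
    exact Real.cos_le_cos_of_nonneg_of_le_pi (by linarith) (by rw [hℓ]; linarith) (by linarith)
  obtain ⟨i₀, -, hmin⟩ := Finset.exists_min_image Finset.univ θ Finset.univ_nonempty
  by_cases hex : ∃ j, j ≠ i₀ ∧ (θ j - θ i₀ < ℓ ∨ 2 * π - ℓ ≤ θ j - θ i₀)
  · obtain ⟨j, hj, h⟩ := hex
    rcases h with h | h
    · refine ⟨j, i₀, hj, hclose j i₀ ?_⟩
      rw [abs_le]; constructor <;> linarith [hmin j (Finset.mem_univ j)]
    · exact ⟨j, i₀, hj, hfar j i₀ h⟩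
  · push Not at hex
    -- the five others fall into the four bins `1, …, 4`
    set f : Fin 6 → ℕ := fun j => ⌊(θ j - θ i₀) / ℓ⌋₊ with hf
    have hmaps : ∀ j ∈ Finset.univ.erase i₀, f j ∈ Finset.Icc 1 4 := by
      intro j hj
      obtain ⟨h1, h2⟩ := hex j (Finset.ne_of_mem_erase hj)
      have hd0 : 0 ≤ (θ j - θ i₀) / ℓ := div_nonneg (by linarith [hmin j (Finset.mem_univ j)]) hℓ0.le
      rw [Finset.mem_Icc, hf]
      constructor
      · rw [Nat.one_le_floor_iff, le_div_iff₀ hℓ0]; linarith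
      · rw [← Nat.lt_succ_iff, Nat.floor_lt hd0, div_lt_iff₀ hℓ0]
        push_cast
        have : 2 * π = 6 * ℓ := by rw [hℓ]; ring
        linarith
    have hcard : (Finset.Icc 1 4).card < (Finset.univ.erase i₀).card := by
      rw [Finset.card_erase_of_mem (Finset.mem_univ _), Finset.card_univ, Fintype.card_fin]
      simp
    obtain ⟨j, hj, j', hj', hne, hjj⟩ := Finset.exists_ne_map_eq_of_card_lt_of_maps_to hcard hmaps
    refine ⟨j, j', hne, hclose j j' ?_⟩
    have hdj : 0 ≤ (θ j - θ i₀) / ℓ := div_nonneg (by linarith [hmin j (Finset.mem_univ j)]) hℓ0.le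
    have hdj' : 0 ≤ (θ j' - θ i₀) / ℓ := div_nonneg (by linarith [hmin j' (Finset.mem_univ j')]) hℓ0.le
    have h1 : ((f j : ℕ) : ℝ) ≤ (θ j - θ i₀) / ℓ := Nat.floor_le hdj
    have h2 : (θ j - θ i₀) / ℓ < ((f j : ℕ) : ℝ) + 1 := Nat.lt_floor_add_one _
    have h3 : ((f j' : ℕ) : ℝ) ≤ (θ j' - θ i₀) / ℓ := Nat.floor_le hdj'
    have h4 : (θ j' - θ i₀) / ℓ < ((f j' : ℕ) : ℝ) + 1 := Nat.lt_floor_add_one _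
    have h5 : ((f j : ℕ) : ℝ) = ((f j' : ℕ) : ℝ) := by exact_mod_cast hjj
    have e1 : θ j - θ j' = ((θ j - θ i₀) / ℓ - (θ j' - θ i₀) / ℓ) * ℓ := by
      field_simp
      ring
    have hlt : |(θ j - θ i₀) / ℓ - (θ j' - θ i₀) / ℓ| ≤ 1 := by
      rw [abs_le]; constructor <;> linarith
    rw [e1, abs_mul, abs_of_pos hℓ0]
    calc |(θ j - θ i₀) / ℓ - (θ j' - θ i₀) / ℓ| * ℓ ≤ 1 * ℓ := mul_le_mul_of_nonneg_right hlt hℓ0.le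
      _ = ℓ := one_mul ℓ

/-- Six planar vectors of norm² `3/4` are not pairwise at distance² `≥ 1`. -/
theorem six_planar_false (z : Fin 6 → ℂ) (hn : ∀ i, ‖z i‖ ^ 2 = 3 / 4)
    (hsep : ∀ i j, i ≠ j → 1 ≤ ‖z i - z j‖ ^ 2) : False := by
  have hne : ∀ i, z i ≠ 0 := by
    intro i h
    have := hn i
    rw [h, norm_zero] at this
    norm_num at this
  obtain ⟨i, j, hij, hcos⟩ := exists_cos_sub_ge_six (fun i => Complex.arg (z i))
    (fun i => Complex.neg_pi_lt_arg _) (fun i => Complex.arg_le_pi _)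
  rw [Real.cos_pi_div_three] at hcos
  have hre := re_mul_add_im_mul (z i) (z j) (hne i) (hne j)
  have hexp : ‖z i - z j‖ ^ 2 = ‖z i‖ ^ 2 + ‖z j‖ ^ 2 - 2 * ((z i).re * (z j).re + (z i).im * (z j).im) := by
    rw [Complex.sq_norm, Complex.sq_norm, Complex.sq_norm, Complex.normSq_apply, Complex.normSq_apply,
      Complex.normSq_apply, Complex.sub_re, Complex.sub_im]
    ring
  have hn0 : 0 ≤ ‖z i‖ := norm_nonneg _
  have hn1 : 0 ≤ ‖z j‖ := norm_nonneg _
  have hprod : ‖z i‖ * ‖z j‖ = 3 / 4 := by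
    have h1 : (‖z i‖ * ‖z j‖) ^ 2 = (3 / 4) ^ 2 := by rw [mul_pow, hn i, hn j]; norm_num
    have h0 : 0 ≤ ‖z i‖ * ‖z j‖ := mul_nonneg hn0 hn1
    nlinarith [h1, h0]
  have key : (3 / 4 : ℝ) * (1 / 2) ≤ ‖z i‖ * ‖z j‖ * Real.cos (Complex.arg (z i) - Complex.arg (z j)) := by
    rw [hprod]; exact mul_le_mul_of_nonneg_left hcos (by norm_num)
  have := hsep i j hij
  rw [hexp, hre, hn i, hn j] at this
  linarith

/-- **Six unit vectors at height exactly `1/2` over a unit vector `e`, pairwise a unit apart, do not exist**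
(six points on a circle of radius `√3/2` pairwise `≥ 1` apart). -/
theorem six_ring_vectors_false (e : EuclideanSpace ℝ (Fin 3)) (he : ‖e‖ = 1)
    (w : Fin 6 → EuclideanSpace ℝ (Fin 3)) (hw1 : ∀ i, ‖w i‖ = 1) (hwe : ∀ i, ⟪w i, e⟫_ℝ = 1 / 2)
    (hsep : ∀ i j, i ≠ j → 1 ≤ ‖w i - w j‖) : False := by
  set e₃ : EuclideanSpace ℝ (Fin 3) := EuclideanSpace.single 2 1 with he₃def
  have he₃ : ‖e₃‖ = 1 := by rw [he₃def, PiLp.norm_single, norm_one]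
  have hin3 : ∀ v : EuclideanSpace ℝ (Fin 3), ⟪v, e₃⟫_ℝ = v 2 := by
    intro v; rw [he₃def, EuclideanSpace.inner_single_right]; simp
  set A := (ℝ ∙ (e - e₃))ᗮ.reflection with hA
  have hAe : A e = e₃ := by rw [hA]; exact Submodule.reflection_sub (by rw [he, he₃])
  set a : Fin 6 → EuclideanSpace ℝ (Fin 3) := fun i => A (w i) with ha
  have ha2 : ∀ i, a i 2 = 1 / 2 := by
    intro i; rw [← hin3, ha, ← hAe, LinearIsometryEquiv.inner_map_map, hwe]
  have hasub : ∀ i j, a i - a j = A (w i - w j) := by intro i j; rw [ha, map_sub]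
  have ha2' : ∀ i j, (a i - a j) 2 = 0 := by
    intro i j
    have : (a i - a j) 2 = a i 2 - a j 2 := by simp
    rw [this, ha2, ha2]; ring
  have hna : ∀ i, ‖a i‖ = 1 := by intro i; rw [ha, LinearIsometryEquiv.norm_map, hw1]
  have hna' : ∀ i j, ‖a i - a j‖ = ‖w i - w j‖ := by
    intro i j; rw [hasub, LinearIsometryEquiv.norm_map]
  have hsq : ∀ v : EuclideanSpace ℝ (Fin 3), ‖v‖ ^ 2 = v 0 ^ 2 + v 1 ^ 2 + v 2 ^ 2 := by
    intro v; rw [EuclideanSpace.real_norm_sq_eq, Fin.sum_univ_three]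
  set z : Fin 6 → ℂ := fun i => ⟨a i 0, a i 1⟩ with hz
  have hzn : ∀ i, ‖z i‖ ^ 2 = 3 / 4 := by
    intro i
    rw [Complex.sq_norm, hz, Complex.normSq_mk]
    have := hsq (a i); rw [hna i, one_pow, ha2 i] at this
    nlinarith [this]
  have hzd : ∀ i j, ‖z i - z j‖ ^ 2 = ‖w i - w j‖ ^ 2 := by
    intro i j
    have e1 : z i - z j = ⟨(a i - a j) 0, (a i - a j) 1⟩ := by
      rw [hz]; apply Complex.ext <;> simp
    rw [Complex.sq_norm, e1, Complex.normSq_mk, ← hna' i j]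
    have := hsq (a i - a j); rw [ha2' i j] at this
    nlinarith [this]
  refine six_planar_false z hzn (fun i j hij => ?_)
  rw [hzd]
  have h1 := hsep i j hij
  nlinarith [h1]

/-- **Two touching balls have at most five common touching neighbours** in any configuration of points pairwise
`≥ 1` apart. -/
theorem card_commonNeighbours_le_five (u a : EuclideanSpace ℝ (Fin 3)) (hua : dist u a = 1)
    (C : Finset (EuclideanSpace ℝ (Fin 3))) (hsep : ∀ x ∈ C, ∀ y ∈ C, x ≠ y → 1 ≤ dist x y)
    (hu : ∀ x ∈ C, dist u x = 1) (haC : ∀ x ∈ C, dist a x = 1) : C.card ≤ 5 := by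
  by_contra hlt
  push Not at hlt
  obtain ⟨T, hT, hTcard⟩ := Finset.exists_subset_card_eq (show 6 ≤ C.card by omega)
  have e : Fin 6 ≃ T := (T.equivFin.trans (finCongr hTcard)).symm
  set w : Fin 6 → EuclideanSpace ℝ (Fin 3) := fun i => ((e i : T) : EuclideanSpace ℝ (Fin 3)) - u with hw
  have nrm : ∀ {p : EuclideanSpace ℝ (Fin 3)}, dist u p = 1 → ‖p - u‖ = 1 := by
    intro p h; rwa [← dist_eq_norm, dist_comm]
  have hA : ‖a - u‖ = 1 := nrm hua
  refine six_ring_vectors_false (a - u) hA w (fun i => nrm (hu _ (hT (e i).2))) (fun i => ?_) (fun i j hij => ?_)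
  · rw [real_inner_comm]
    refine inner_eq_half_of_unit_triangle hA (nrm (hu _ (hT (e i).2))) ?_
    have : ((e i : T) : EuclideanSpace ℝ (Fin 3)) - u - (a - u) = ((e i : T) : EuclideanSpace ℝ (Fin 3)) - a := by
      abel
    rw [hw]; dsimp only; rw [this, ← dist_eq_norm, dist_comm]
    exact haC _ (hT (e i).2)
  · have hne : ((e i : T) : EuclideanSpace ℝ (Fin 3)) ≠ (e j : T) := fun h =>
      hij (e.injective (Subtype.ext h))
    have : w i - w j = ((e i : T) : EuclideanSpace ℝ (Fin 3)) - (e j : T) := by rw [hw]; dsimp only; abel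
    rw [this, ← dist_eq_norm]
    exact hsep _ (hT (e i).2) _ (hT (e j).2) hne

end Summit.Ventures.Crystal3D.Theorems

end
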